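import Summits.AnomalousDissipation.AnomalousDissipation.Theses.TaylorCertificates
import Summits.AnomalousDissipation.AnomalousDissipation.Theorems.EnsembleCeiling.Negative.SingleModeFat
import Summits.AnomalousDissipation.AnomalousDissipation.Theorems.EnsembleCeiling.Negative.OrthogonalClassFat
import Summits.AnomalousDissipation.AnomalousDissipation.Theorems.EnsembleCeiling.Negative.DiracAtoms
import Summits.AnomalousDissipation.AnomalousDissipation.Theorems.EnsembleCeiling.Negative.BeltramiFat
import Summits.AnomalousDissipation.AnomalousDissipation.Theorems.EnsembleCeiling.Negative.CellularFat
import Literature.Analysis.FluidPDE.StatisticalSolutionEnergyEq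
import Literature.Analysis.FluidPDE.EnergySpaceRellich
import Literature.Analysis.FluidPDE.CylindricalGenerator

/-!
# Line `radiation-functional-outer-peeling` for crux `TaylorCertificates.EnsembleCeiling`
# (stmt-AnomalousDissipation-14090, rank 4) — crux-plan skeleton, round 1, 2026-08-16

Planner `planner-cruxplan-stmt-AnomalousDissipation-14090-radiation-functional-0`; idea card
`Cruxes/EnsembleCeiling/Ideas/radiation-functional-outer-peeling.md` (ideator 1, triage 3/3 pass), line card
`Cruxes/EnsembleCeiling/Lines/radiation-functional-outer-peeling.md`.

## The crux (read back from the route file, rev 12)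

`EnsembleCeiling`: ONE smooth divergence-free mean-zero force `f ≠ 0` on `T³` and `E, ν₀` such that for every
`ν ∈ (0, ν₀)` EVERY stationary statistical solution `μ` of `NS_ν(f)` (FMRT IV Def. 1.3, the tree's
`Torus.IsStationaryStatisticalSolution`: probability on `H`, finite mean enstrophy (1.29), Liouville (1.30) for all
cylindrical tests, shell energy inequalities (1.31)) has mean energy `∫ |u|² dμ ≤ E` — ν-UNIFORMLY. A priori only the
support bound `|u| ≤ s_f(ν) := ‖f‖₂/(4π²ν)` holds (FMRT (1.34), tree `ae_norm_le`, PROVED; attained by the Kolmogorov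
laminar Dirac, Disproof `support_bound_attained`).

## The line: blow down at the Grashof scale, peel the top with the radiation coordinate, descend

GRASHOF BLOW-DOWN. Rescale states by `s_f(ν)`: `v = u / s_f(ν)`. By the exact amplitude covariance of the FMRT
class, the push-forward of a stationary statistical solution of `NS_ν(f)` is one of `NS_{ν'}(f')` with
`ν' = 4π²ν²/‖f‖₂ → 0`, `f' = (4π²ν/‖f‖₂)² f → 0`, carried by the CLOSED UNIT BALL of `H`, with the shell
inequalities turned into the ν-FREE budget `E[‖∇v‖²; shell] ≤ 4π² E[(v, f̂); shell]`, `f̂ = f/‖f‖₂` — hence mean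
enstrophy `≤ 4π²`, hence tightness (Rellich). Weak limits along `ν_n → 0` are GRASHOF LIMITS (`IsGrashofLimit`):
Euler-stationary statistics (`IsStationaryStatisticalSolution 0 0`, the tree predicate admits it) on the unit ball
obeying the `f̂`-budget (`IsResonantEulerStatistics`). The crux splits EXACTLY into
  (Grashof regime)  every Grashof limit of `f` is `δ₀`  ⇔  `SubGrashof f` : `ν² · ensembleEnergy μ → 0` uniformly
                    over stationary statistics (S1 `stub_grashofBlowdown` is `⇐`, PROVABLE; `⇒` is elementary), and
  (sub-Grashof)     `SubGrashof f → CeilingAt f` (S4 `stub_subGrashofCeiling`, OPEN — the crux's core, which no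
                    round-1 card reaches; this line contributes nothing to it beyond naming it precisely).
RADIATION / PEELING (the idea's lever, Grashof regime, TOP RUNG). For a FIRST-SHELL force whose Lamb vector is
visible (`IsPeelableForce`: `Δf = -4π²f`, `∫⟪(f·∇)f, w⟫ ≠ 0` for some test field `w` — exactly the complement of the
Marchioro / single-shell-Euler-steady class of the Disproof), the budget pins Grashof-limit mass near the top level
`‖v‖ ≈ 1` onto the non-steady point `f̂` (alignment pincer: on `{‖v‖² ≥ a}`, `E‖Q₁v‖² ≤ (1-√a)·mass`,
`E[misalignment] ≤ 3(1-√a)·mass`), where the RADIATION COORDINATE `ρ(v) = (v, w₀)`, `w₀ = PB(f̂,f̂)/‖PB(f̂,f̂)‖` (shell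
`√2`), has Euler drift `ρ̇ = -(B(v,v), w₀) ≤ -β₀‖P₁v‖²/2` on the aligned cone (`β₀ = ‖PB(f̂,f̂)‖ > 0`). Liouville with the
cylindrical test `ρ · R(‖P₂v‖²) · Ξ(P₁v)` (level proxy `‖P₂v‖²`: the first-order exchange `B(P₁v,P₁v)` lies in shell `√2`
⊂ range `P₂`, so the flux out of `P₂` is `O(‖Q₁v‖ ‖Q₂v‖ (1 + ‖∇Q₁v‖^{3/4}))` with `‖Q₂v‖² ≤ 1 - a` POINTWISE on the ramp
`{‖P₂v‖² ≥ a}` — second moments suffice) gives a RATIO LAW `η{‖v‖² ≥ a'} ≤ c(a) · η{‖v‖² ≥ a₋}` with `c(a) → 0` as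
`a → 1`; iterating downward: the TAIL BOUND S2 `stub_radiationTail` (∀ ε ∃ θ < 1: every resonant Euler statistics
charges `{‖v‖ > θ}` by at most `ε`), uniformly over the whole first-order class — the measure form of the card's
`OuterShellPeeling`, PROVABLE (L) by the estimates recorded in the line card; its Dirac slice at finite `ν` is S0
`stub_steadyTopExclusion` (PROVABLE NOW, M: the two-line Lamb-test estimate re-derived by all three triagers).
ZERO mass at a FIXED level does NOT follow from first-order tests (the `P₁ ↔ Q₁` energy-exchange term
`2β‖P₁v‖²ρ² R'` has the sign and the order of the main term — the card's "transition-zone term", now located exactly);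
it is part of the descent.
DESCENT (the bet). S3 `stub_grashofDescent`: for ONE peelable force, the top tail bound upgrades to "every Grashof
level `{‖v‖ > θ}`, `θ > 0`, is null for every Grashof LIMIT" — second-order frustration of the resonant directions
(first-shell steady Euler fields `E₊ ∪ E₋ ∪` 2½-D cones `∪` shears, TRIAGE-r1-2 §Kit, dressed by correctors), level by
level. Stated over Grashof LIMITS (which remember the force at second order through the approximating sequence), NOT
over the first-order class: every nonzero `f` has resonant single-mode DIRECTIONS `δ_{θ m̂}`, `θ ≤ (f̂, m̂)`, in the
first-order class, so the first-order version is false for every force. `f_GP = h₊ + h₋` FAILS S3 at `θ = 1/√2`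
(TRIAGE-r1-1 N1: fat Beltrami-ray branch `h₊/(4π²ν) + O(ν)`, K = 4, 6 Galerkin + DNS from rest) and is not a
witness; screened candidates: `f_a = h₊ + T_a h₋` (generic `a`), generic first-shell 3-D polarisations.
COMPOSITION `EnsembleCeiling_of` (PROVED, pure logic): S3 gives `f`; S2 (with S0) gives the top tail for all resonant
statistics, in particular for Grashof limits; S3 makes every Grashof level null, so every Grashof limit has energy `0`
(`ensembleEnergy_eq_zero_of_levels_null`); S1 (contrapositive) gives `SubGrashof f`; S4 gives `CeilingAt f`; pack.

## Stubs (5; sorries ONLY here): S0 M provable-now · S1 L provable · S2 L provable (engine) · S3 OPEN (bet) · S4 OPEN (core, hardest)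

All five are stated over TREE VOCABULARY ONLY (so each lands verbatim as
`Theorems/TaylorCertificatesEnsembleCeiling<Stub>.lean --supports stmt-AnomalousDissipation-14090`); the local
vocabulary of the composition (`IsPeelableForce`, `SubGrashof`, `IsResonantEulerStatistics`, `IsGrashofLimit`,
`CeilingAt`, …) is definitionally equal to the expanded blocks and bridged by `Iff.rfl`.

## Disproof.lean (cdisprove rev 2, NO KILL) honoured

* `ensembleCeiling_false_without_liouville` (any proof must use (1.30)): Liouville is used at S1 (it survives the
  blow-down as Euler-stationarity of Grashof limits), at S2 (the radiation test is a cylindrical Liouville test) and at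
  S3; S0 uses the steady equation (= Liouville at an atom, `DiracAtoms.isSteadyWeakSolution_of_dirac`).
* `ensembleEnergy_le_support_bound` / `support_bound_attained` (nothing seeing `f` only through `‖f‖₂` works): the line
  uses the GEOMETRY of `f` through `β₀ = ‖PB(f̂,f̂)‖ > 0` (S0, S2) and the resonant-direction structure of `f̂` (S3).
* Dead classes (`not_ceilingAt_singleMode`, `_orthogonalClass`, `_singleShell_eulerSteady`, `_abc`, `_cellular`):
  every single-shell weakly Euler-steady force violates `IsPeelableForce` (Lamb vector invisible), in particular single
  modes, the orthogonal class restricted to the first shell and the ABC forces; cellular forces live on shell `√2`, not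
  first-shell. No stub is an instance of a landed Negative lemma (the five Negative files are imported below and
  coexist). `ensembleCeiling_iff_withoutIntegrable`: the composition carries the decorative `Integrable` hypothesis
  verbatim (`CeilingAt`).
* Negatives index (5): 13037 TaylorCertificatePair (band-limited certificates; this line has no certificate),
  2979/2984 (drift data; everything here lives on mean-zero `H`), 0204, 2859 unrelated.
-/

noncomputable section

set_option linter.dupNamespace false
set_option linter.unusedVariables false

namespace Summit.AnomalousDissipation.AnomalousDissipation.Cruxes.EnsembleCeiling.RadiationFunctionalOuterPeeling

open MeasureTheory Filter Topology UnitAddTorus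
open scoped InnerProductSpace ENNReal NNReal
open Literature.Analysis.FunctionSpaces Literature.Analysis.FluidPDE
open Summit.AnomalousDissipation.AnomalousDissipation.Theses.TaylorCertificates
open Summit.AnomalousDissipation.AnomalousDissipation.Theorems.EnsembleCeiling.Negative

/-- Local notation: real vector fields on `T³`. -/
local notation "Vec3" => (UnitAddTorus (Fin 3)) → (EuclideanSpace ℝ (Fin 3))
/-- Local notation: `L²(T³; ℝ³)`. -/
local notation "L2" => (Lp (EuclideanSpace ℝ (Fin 3)) 2 (volume : Measure (UnitAddTorus (Fin 3))))
/-- Local notation: the energy space `H` (Borel σ-algebra from `StatisticalSolution.lean`). -/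
local notation "H3" => (Torus.energySpace (Fin 3))

/-! ## The stubs — tree vocabulary only -/

/-- **S0 `stub_steadyTopExclusion`** — THE DIRAC SLICE OF THE PEELING THEOREM (provable now, size M; the card's
first checkable theorem, re-derived by TRIAGE-r1-1/2/3). For a smooth divergence-free mean-zero FIRST-SHELL force
`f ≠ 0` (`Δf = -4π²f`) whose Lamb vector is visible (`∫⟪(f·∇)f, w⟫ ≠ 0` for some smooth solenoidal mean-zero `w`)
there are `θ < 1` and `ν₀ > 0` such that for `ν < ν₀` every finite-enstrophy steady weak solution `u ∈ V` of `NS_ν(f)`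
has `‖u‖ ≤ θ ‖f‖₂/(4π²ν)` — a ν-UNIFORM factor below the FMRT support radius, which the Kolmogorov / ABC laminar states
attain (`Negative.SingleModeFat`, `Negative.BeltramiFat`: exactly the forces this hypothesis excludes).
Why true (`L := ‖f‖₂/(4π²ν)`): the steady energy identity `ν‖∇u‖² = (f,u)` (tree `SteadyNavierStokesEnergy`) with
`u = u₁ + u'` (first shell + rest) gives `‖u₁‖² + 2‖u'‖² ≤ L‖u₁‖`; if `‖u‖ ≥ θL` then `‖u'‖² ≤ (1-θ²)L²`,
`(f̂,u₁) ≥ θ²L`, so `u = L f̂ + r`, `‖r‖ ≤ (√(2(1-θ²)) + √(1-θ²)) L`; test the steady equation with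
`w₀ = PB(f̂,f̂)/β₀` (shell `√2`, so `(f,w₀) = 0` and `|ν(u,Δw₀)| = 8π²ν|(u',w₀)| ≤ 2‖f‖₂√(1-θ²)`): the inertial term is
`L²(β₀ + O(‖r‖/L))`, whence `L²β₀/2 ≤ 2‖f‖₂√(1-θ²)` — false for `ν` small. Uses Liouville at the atom
(`DiracAtoms.isSteadyWeakSolution_of_dirac`). -/
theorem stub_steadyTopExclusion :
    ∀ f : Vec3, Torus.IsSmooth f → Torus.IsDivFree f → Torus.HasZeroMean f → 0 < (∫ x, ‖f x‖ ^ 2) →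
      (∀ x, Torus.laplacian f x = -((4 * Real.pi ^ 2) • f x)) →
      (∃ w : Vec3, Torus.IsSmooth w ∧ Torus.IsDivFree w ∧ Torus.HasZeroMean w ∧
        (∫ x, inner ℝ (Torus.convect f f x) (w x)) ≠ 0) →
      ∃ θ : ℝ, θ < 1 ∧ ∃ ν₀ : ℝ, 0 < ν₀ ∧ ∀ ν : ℝ, 0 < ν → ν < ν₀ →
        ∀ u : H3, (u : L2) ∈ Torus.energySpaceV (Fin 3) → Torus.IsSteadyWeakSolution ν f u →
          ‖u‖ ≤ θ * Real.sqrt (∫ x, ‖f x‖ ^ 2) / (4 * Real.pi ^ 2 * ν) := by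
  sorry

/-- **S1 `stub_grashofBlowdown`** — GRASHOF BLOW-DOWN COMPACTNESS (provable, size L; the analytic backbone, reusable
by every ceiling line: it is card quiet-fat-blowup-hierarchy's `QuietFatLimit` at `c̄ > 0` and FrustratedForces'
`RescaledSkeletonSSS` for measures). If the stationary statistics of `NS_ν(f)` are NOT uniformly sub-Grashof
(`ν² · ensembleEnergy ↛ 0`), then along some `ν_n → 0` the blow-downs `v = (4π²ν_n/‖f‖₂) u` of stationary
statistical solutions converge weakly (against bounded continuous observables on `H`) to a GRASHOF LIMIT of POSITIVE
mean energy: a probability measure on `H` carried by the closed unit ball, of finite mean enstrophy, Euler-stationary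
(the tree predicate at `ν = 0`, `f = 0`: Liouville for every cylindrical test; shell clause trivial), obeying the
blown-down shell budget `E[‖∇v‖²; a < ‖v‖² < b] ≤ 4π² E[(v,f̂)⁺; a ≤ ‖v‖² ≤ b]`.
Why true: (i) COVARIANCE (exact, field by field; card quiet-fat-blowup-hierarchy's `ScalingCovariance`, checked by
TRIAGE-r1-2/3): the push-forward of `μ ∈ SSS(ν,f)` under `u ↦ cu`, `c = 4π²ν/‖f‖₂`, lies in `SSS(cν, c²f)` —
concretely Liouville with the rescaled test (test fields `c gᵢ`, same profile) reads
`∫ [c²(f,Φ'(v)) + cν (v,ΔΦ'(v)) + ∫(v⊗v):∇Φ'(v)] dη_c = 0`, and the shell inequality on `{a ≤ ‖v‖² < b}` becomes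
`E[‖∇v‖²; S] ≤ 4π² E[(v,f̂); S]` EXACTLY (`c/ν = 4π²/‖f‖₂`); (ii) SUPPORT: `‖v‖ ≤ 1` a.s. (`ae_norm_le`, FMRT (1.34)); (iii) TIGHTNESS:
`E‖∇v‖² ≤ 4π²` (budget with `S = H`, `energy_le_holds`), Markov + Rellich `Torus.isCompact_setOf_eGradNormSq_le`,
Prokhorov on the Polish space `H` (Mathlib `isCompact_closure_of_isTightMeasureSet`, Lévy–Prokhorov metrisability),
so a subsequence converges; (iv) LIMIT: constants give probability; the closed ball is closed (portmanteau); mean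
enstrophy is lsc (`Theorems/TaylorCertificatesFloorCertificateStubLscEnstrophy`, LANDED); the generator
`v ↦ ∫(v⊗v):∇Φ'(v)` is continuous (`continuous_nsGeneratorPairing_grad`) and bounded on the ball (retract radially to a
bounded continuous function), the `c²`- and `cν`-terms are `O(c) → 0`, so Euler–Liouville passes to the limit;
the budget passes with `lsc × open` on the left and `usc × closed`, positive part, on the right; the energy
`min(‖v‖²,1)` is bounded continuous, so `ensembleEnergy η = lim c_n² E‖u‖² ≥ 16π⁴c/‖f‖₂² > 0`. -/
theorem stub_grashofBlowdown :
    ∀ f : Vec3, Torus.IsSmooth f → Torus.IsDivFree f → Torus.HasZeroMean f → 0 < (∫ x, ‖f x‖ ^ 2) →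
      (¬ ∀ c : ℝ, 0 < c → ∃ ν₁ : ℝ, 0 < ν₁ ∧ ∀ ν : ℝ, 0 < ν → ν < ν₁ →
          ∀ μ : Measure H3, Torus.IsStationaryStatisticalSolution ν f μ → ν ^ 2 * Torus.ensembleEnergy μ ≤ c) →
      ∃ η : Measure H3,
        ((∃ (ν : ℕ → ℝ) (μ : ℕ → Measure H3), (∀ n, 0 < ν n) ∧ Tendsto ν atTop (𝓝 0) ∧
            (∀ n, Torus.IsStationaryStatisticalSolution (ν n) f (μ n)) ∧
            ∀ g : BoundedContinuousFunction H3 ℝ,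
              Tendsto (fun n => ∫ v, g v ∂(Measure.map
                (fun u : H3 => (4 * Real.pi ^ 2 * ν n / Real.sqrt (∫ x, ‖f x‖ ^ 2)) • u) (μ n)))
                atTop (𝓝 (∫ v, g v ∂η))) ∧
          (Torus.IsStationaryStatisticalSolution 0 (0 : Vec3) η ∧
            (∀ᵐ v ∂η, ‖v‖ ≤ 1) ∧
            ∀ a b : ℝ, 0 ≤ a → a < b →
              (∫⁻ v in {v : H3 | a < ‖v‖ ^ 2 ∧ ‖v‖ ^ 2 < b}, Torus.eGradNormSq ((v : L2) : Vec3) ∂η).toReal ≤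
                4 * Real.pi ^ 2 * ∫ v in {v : H3 | a ≤ ‖v‖ ^ 2 ∧ ‖v‖ ^ 2 ≤ b},
                  max (Torus.pairing (v : L2) f / Real.sqrt (∫ x, ‖f x‖ ^ 2)) 0 ∂η)) ∧
        0 < Torus.ensembleEnergy η := by
  sorry

/-- **S2 `stub_radiationTail`** — THE RADIATION TAIL BOUND (the engine of the line; provable, size L; NEW), GIVEN S0.
For a peelable force `f` (first shell, visible Lamb vector) and every `ε > 0` there is `θ < 1` such that EVERY resonant
Euler statistics of `f` (probability on `H`, unit ball, finite enstrophy, Euler-stationary, `f̂`-budget — in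
particular every Grashof limit) charges the top region `{‖v‖ > θ}` by at most `ε`: the blown-down stationary statistics
of `NS_ν(f)` desert the top of the Grashof ball uniformly, the measure form of the card's `OuterShellPeeling`.
Why true (all constants explicit, second moments only; see the line card §S2 for the bookkeeping): write `v = y + q`,
`y = P₁v`; on `{‖v‖² ≥ a}` the budget gives the PINCER `E‖q‖² ≤ δ·mass`, `E[‖y‖ - (f̂,y)] ≤ 3δ·mass`,
`E‖∇q‖² ≤ 4π²δ·mass`, `δ = 1 - √a`. RADIATION COORDINATE `ρ(v) = (v,w₀)`, `w₀ = PB(f̂,f̂)/β₀`: its Euler drift is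
`-(B(v,v),w₀) = -‖y‖²(B(ŷ,ŷ),w₀) + O(‖q‖ + ‖q‖²)` with `(B(ŷ,ŷ),w₀) ≥ β₀/2` on the aligned cone. Test Liouville with the
cylindrical functional `T = ρ · R(‖P₂v‖²) · Ξ(y)` (`R` a ramp `0 → 1` on proxy levels `[a, a']`, `Ξ` an angular cut-off
at a fixed angle `κ(β₀)`; coordinates = the finitely many modes `|k|² ≤ 4`): the level-proxy term
`ρ R' d‖P₂v‖²/dt` involves only the flux OUT of `P₂`, which is `O(‖q‖ ‖Q₂v‖ (1 + ‖∇q‖^{3/4}))` because the first-order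
exchange `B(y,y)` lies in shell `√2 ⊂ P₂` (first-shell algebra, TRIAGE-r1-3) and `‖Q₂v‖² ≤ 1 - a` POINTWISE on the ramp;
with Gagliardo–Nirenberg on `T³` and Hölder every error is `O(√δ)·mass`, so
`β₀ · E[RΞ] ≤ C√δ · η{‖v‖² ≥ a}` — a RATIO LAW with a SMALL constant; converting proxy levels back to true levels costs
`‖Q₂v‖²` (Chebyshev, one more ratio step) and iterating the law down a geometric ladder of levels gives
`η{‖v‖² ≥ a₁} ≤ ∏ c(a_k) → 0` as `a₁ → 1`, uniformly in `η`. (Zero mass at a FIXED level is NOT claimed: the exchange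
term `2β₀‖y‖²ρ²R'` is of the order of the main term — the card's transition-zone obstruction — and is left to S3.)
S0 enters as the atom case and fixes the scale of `θ`. -/
theorem stub_radiationTail :
    (∀ f : Vec3, Torus.IsSmooth f → Torus.IsDivFree f → Torus.HasZeroMean f → 0 < (∫ x, ‖f x‖ ^ 2) →
      (∀ x, Torus.laplacian f x = -((4 * Real.pi ^ 2) • f x)) →
      (∃ w : Vec3, Torus.IsSmooth w ∧ Torus.IsDivFree w ∧ Torus.HasZeroMean w ∧
        (∫ x, inner ℝ (Torus.convect f f x) (w x)) ≠ 0) →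
      ∃ θ : ℝ, θ < 1 ∧ ∃ ν₀ : ℝ, 0 < ν₀ ∧ ∀ ν : ℝ, 0 < ν → ν < ν₀ →
        ∀ u : H3, (u : L2) ∈ Torus.energySpaceV (Fin 3) → Torus.IsSteadyWeakSolution ν f u →
          ‖u‖ ≤ θ * Real.sqrt (∫ x, ‖f x‖ ^ 2) / (4 * Real.pi ^ 2 * ν)) →
    ∀ f : Vec3, Torus.IsSmooth f → Torus.IsDivFree f → Torus.HasZeroMean f → 0 < (∫ x, ‖f x‖ ^ 2) →
      (∀ x, Torus.laplacian f x = -((4 * Real.pi ^ 2) • f x)) →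
      (∃ w : Vec3, Torus.IsSmooth w ∧ Torus.IsDivFree w ∧ Torus.HasZeroMean w ∧
        (∫ x, inner ℝ (Torus.convect f f x) (w x)) ≠ 0) →
      ∀ ε : ℝ, 0 < ε → ∃ θ : ℝ, θ < 1 ∧ ∀ η : Measure H3,
        (Torus.IsStationaryStatisticalSolution 0 (0 : Vec3) η ∧
          (∀ᵐ v ∂η, ‖v‖ ≤ 1) ∧
          ∀ a b : ℝ, 0 ≤ a → a < b →
            (∫⁻ v in {v : H3 | a < ‖v‖ ^ 2 ∧ ‖v‖ ^ 2 < b}, Torus.eGradNormSq ((v : L2) : Vec3) ∂η).toReal ≤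
              4 * Real.pi ^ 2 * ∫ v in {v : H3 | a ≤ ‖v‖ ^ 2 ∧ ‖v‖ ^ 2 ≤ b},
                max (Torus.pairing (v : L2) f / Real.sqrt (∫ x, ‖f x‖ ^ 2)) 0 ∂η) →
        η {v : H3 | θ < ‖v‖} ≤ ENNReal.ofReal ε := by
  sorry

/-- **S3 `stub_grashofDescent`** — THE GRASHOF DESCENT FOR ONE FORCE (OPEN; the line's bet). There is a peelable
force `f` (smooth, solenoidal, mean-zero, nonzero, first-shell, visible Lamb vector) for which the top tail bound of
S2 upgrades to: EVERY Grashof level `{‖v‖ > θ}`, `θ > 0`, is NULL for EVERY Grashof limit of `f` (weak limit of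
blow-downs `(4π²ν_n/‖f‖₂)·u` of stationary statistical solutions of `NS_{ν_n}(f)`, `ν_n → 0`, which is a resonant Euler
statistics). Equivalently: the stationary statistics of `NS_ν(f)` carry no ν-independent mass fraction at ANY fixed
fraction of the Grashof radius. CONTENT, level by level (the card's θ-induction "peel from θ = 1 inward"): at level
`θ` the budget admits RESONANT DIRECTIONS — steady Euler fields `V`, `‖V‖ = θ`, with `‖∇V‖² ≤ 4π²(f̂,V)`, i.e.
first-shell-dominated members of `S₁ = E₊ ∪ E₋ ∪ {2½-D cones} ∪ {shears}` (TRIAGE-r1-2 §Kit) at work-cosine `≥ θ`,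
and diffuse Euler-stationary families near them; a Grashof LIMIT can charge them only if the force is absorbed at
second order (`f - (f,V̂)·4π²θ V̂ ∈ cl(Ran L_V + tangent Reynolds stresses)`, the corrector law of card
quiet-fat-blowup-hierarchy / TRIAGE-r1-3 A1) — the descent is the claim that for the witness every such direction is
FRUSTRATED and frustration propagates to measures. Why it might fail: `f_GP = h₊ + h₋` fails at `θ = 1/√2`
(TRIAGE-r1-1 N1: `h₋ ∈ Ran L_{h₊}` with an `O(ν)` smooth corrector — fat Beltrami-ray branch, K = 4, 6 + DNS); every
first-shell force might be absorbed on some skeleton at higher order (O(1)-halo Reynolds stresses, Grashof-scale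
cycling between skeletons: the gap (δ) of TRIAGE-r1-3); diffuse Euler-stationary families are constrained only by the
corrector law. Candidates: `f_a = h₊ + T_a h₋`, generic `a` (Birkhoff-average obstruction `ρ_a ≠ 0`, card
beltrami-island-flux / TRIAGE-r1-3 sharpening; kit screen j009254 pending), generic first-shell 3-D polarisations.
Stated with the S2 tail as hypothesis (the top is S2's job). -/
theorem stub_grashofDescent :
    ∃ f : Vec3, (Torus.IsSmooth f ∧ Torus.IsDivFree f ∧ Torus.HasZeroMean f ∧ 0 < (∫ x, ‖f x‖ ^ 2)) ∧
      (∀ x, Torus.laplacian f x = -((4 * Real.pi ^ 2) • f x)) ∧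
      (∃ w : Vec3, Torus.IsSmooth w ∧ Torus.IsDivFree w ∧ Torus.HasZeroMean w ∧
        (∫ x, inner ℝ (Torus.convect f f x) (w x)) ≠ 0) ∧
      ((∀ ε : ℝ, 0 < ε → ∃ θ : ℝ, θ < 1 ∧ ∀ η : Measure H3,
          ((∃ (ν : ℕ → ℝ) (μ : ℕ → Measure H3), (∀ n, 0 < ν n) ∧ Tendsto ν atTop (𝓝 0) ∧
              (∀ n, Torus.IsStationaryStatisticalSolution (ν n) f (μ n)) ∧
              ∀ g : BoundedContinuousFunction H3 ℝ,
                Tendsto (fun n => ∫ v, g v ∂(Measure.map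
                  (fun u : H3 => (4 * Real.pi ^ 2 * ν n / Real.sqrt (∫ x, ‖f x‖ ^ 2)) • u) (μ n)))
                  atTop (𝓝 (∫ v, g v ∂η))) ∧
            (Torus.IsStationaryStatisticalSolution 0 (0 : Vec3) η ∧
              (∀ᵐ v ∂η, ‖v‖ ≤ 1) ∧
              ∀ a b : ℝ, 0 ≤ a → a < b →
                (∫⁻ v in {v : H3 | a < ‖v‖ ^ 2 ∧ ‖v‖ ^ 2 < b}, Torus.eGradNormSq ((v : L2) : Vec3) ∂η).toReal ≤
                  4 * Real.pi ^ 2 * ∫ v in {v : H3 | a ≤ ‖v‖ ^ 2 ∧ ‖v‖ ^ 2 ≤ b},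
                    max (Torus.pairing (v : L2) f / Real.sqrt (∫ x, ‖f x‖ ^ 2)) 0 ∂η)) →
          η {v : H3 | θ < ‖v‖} ≤ ENNReal.ofReal ε) →
        ∀ θ : ℝ, 0 < θ → ∀ η : Measure H3,
          ((∃ (ν : ℕ → ℝ) (μ : ℕ → Measure H3), (∀ n, 0 < ν n) ∧ Tendsto ν atTop (𝓝 0) ∧
              (∀ n, Torus.IsStationaryStatisticalSolution (ν n) f (μ n)) ∧
              ∀ g : BoundedContinuousFunction H3 ℝ,
                Tendsto (fun n => ∫ v, g v ∂(Measure.map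
                  (fun u : H3 => (4 * Real.pi ^ 2 * ν n / Real.sqrt (∫ x, ‖f x‖ ^ 2)) • u) (μ n)))
                  atTop (𝓝 (∫ v, g v ∂η))) ∧
            (Torus.IsStationaryStatisticalSolution 0 (0 : Vec3) η ∧
              (∀ᵐ v ∂η, ‖v‖ ≤ 1) ∧
              ∀ a b : ℝ, 0 ≤ a → a < b →
                (∫⁻ v in {v : H3 | a < ‖v‖ ^ 2 ∧ ‖v‖ ^ 2 < b}, Torus.eGradNormSq ((v : L2) : Vec3) ∂η).toReal ≤
                  4 * Real.pi ^ 2 * ∫ v in {v : H3 | a ≤ ‖v‖ ^ 2 ∧ ‖v‖ ^ 2 ≤ b},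
                    max (Torus.pairing (v : L2) f / Real.sqrt (∫ x, ‖f x‖ ^ 2)) 0 ∂η)) →
          η {v : H3 | θ < ‖v‖} = 0) := by
  sorry

/-- **S4 `stub_subGrashofCeiling`** — THE SUB-GRASHOF CORE (OPEN; HARDEST; no lever of this line — named, not
attacked). For a peelable force: if its stationary statistics are uniformly sub-Grashof (`ν² · ensembleEnergy ≤ c`
eventually, for every `c > 0` — what S1–S3 deliver), then their mean energy is ν-uniformly BOUNDED (`CeilingAt f`, the
crux's conclusion for `f`, decorative `Integrable` hypothesis kept verbatim). NECESSARY for the crux at `f`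
(`subGrashof_of_ceilingAt`, PROVED below, so the hypothesis costs nothing). Content: exclusion of WARM fat statistics at
every intermediate scale `1 ≪ ‖u‖ ≪ ν⁻¹` — blow-downs at those scales lose the alignment budget (`c̄ = 0`: TRIAGE-r1-2/3
on cards quiet-fat-blowup-hierarchy / fast-euler-averaging), so the enemies are (i) H¹-tight "quiet" warm families
(Dirac: warm steady branches `‖u‖ ≍ ν^{-1/3}` riding shear/Beltrami skeletons — SEEN in the Galerkin census of f_GP,
kit j001684/j001712/j001732, continuum fate open, route MirrorVariety K3) constrained only by second-order corrector
laws, and (ii) rough "loud-in-enstrophy, quiet-in-Kolmogorov-units" families (`β = εℓ/U³ ≤ ‖f‖/U² → 0`: every fat family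
is Kolmogorov-quiet by the energy budget, so this is an ensemble zeroth-law statement for fat statistics). The card's
proposal for this regime ("continue peeling with ν-dependent resolution K ≍ (s_f/‖u‖)^{1/2} down to ‖u‖ ≍ √E, merging
with the graded certificate") has no purchase here: below the Grashof scale the unresolved remainder is O(1) relative
and the alignment pincer is void (line card §S4). Why it might fail: a peelable force with a continuum warm steady
branch and no Grashof-scale statistics refutes it as stated (none known; a kit Newton continuation of the steady
branches of a screened first-shell force decides the Dirac part). -/
theorem stub_subGrashofCeiling :
    ∀ f : Vec3, Torus.IsSmooth f → Torus.IsDivFree f → Torus.HasZeroMean f → 0 < (∫ x, ‖f x‖ ^ 2) →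
      (∀ x, Torus.laplacian f x = -((4 * Real.pi ^ 2) • f x)) →
      (∃ w : Vec3, Torus.IsSmooth w ∧ Torus.IsDivFree w ∧ Torus.HasZeroMean w ∧
        (∫ x, inner ℝ (Torus.convect f f x) (w x)) ≠ 0) →
      (∀ c : ℝ, 0 < c → ∃ ν₁ : ℝ, 0 < ν₁ ∧ ∀ ν : ℝ, 0 < ν → ν < ν₁ →
          ∀ μ : Measure H3, Torus.IsStationaryStatisticalSolution ν f μ → ν ^ 2 * Torus.ensembleEnergy μ ≤ c) →
      ∃ (E ν₀ : ℝ), 0 < ν₀ ∧ ∀ ν : ℝ, 0 < ν → ν < ν₀ → ∀ μ : Measure H3,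
        Torus.IsStationaryStatisticalSolution ν f μ → Integrable (fun v : H3 => ‖v‖ ^ 2) μ →
          Torus.ensembleEnergy μ ≤ E := by
  sorry

/-! ## Vocabulary of the composition (definitionally the blocks above) -/

/-- Admissible forces of the crux: smooth, divergence-free, mean-zero, nonzero in `L²`. -/
def IsAdmissibleForce (f : Vec3) : Prop :=
  Torus.IsSmooth f ∧ Torus.IsDivFree f ∧ Torus.HasZeroMean f ∧ 0 < (∫ x, ‖f x‖ ^ 2)

/-- `f` lies in the FIRST Stokes shell: `Δf = -4π²f` (so the FMRT support bound reads `‖u‖ ≤ ‖f‖₂/(4π²ν)` and is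
attained exactly by laminar states). -/
def IsFirstShell (f : Vec3) : Prop :=
  ∀ x, Torus.laplacian f x = -((4 * Real.pi ^ 2) • f x)

/-- The Lamb vector of `f` is VISIBLE: `(f·∇)f` is not a gradient, i.e. `f̂` is NOT a steady Euler field — some smooth
solenoidal mean-zero test field pairs non-trivially with it (`β₀ := ‖PB(f̂,f̂)‖ > 0`). The complement, inside one
shell, of the Marchioro / Disproof dead class `not_ceilingAt_singleShell_eulerSteady`. -/
def LambVisible (f : Vec3) : Prop :=
  ∃ w : Vec3, Torus.IsSmooth w ∧ Torus.IsDivFree w ∧ Torus.HasZeroMean w ∧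
    (∫ x, inner ℝ (Torus.convect f f x) (w x)) ≠ 0

/-- PEELABLE forces — the witness class of the line: admissible, first-shell, visible Lamb vector
(e.g. `f_a = h₊ + T_a h₋`; `f_GP` is peelable but fails S3). -/
def IsPeelableForce (f : Vec3) : Prop :=
  IsAdmissibleForce f ∧ IsFirstShell f ∧ LambVisible f

/-- The conclusion of the crux AT the force `f` (verbatim the crux's inner block; same as Disproof `CeilingAt`). -/
def CeilingAt (f : Vec3) : Prop :=
  ∃ (E ν₀ : ℝ), 0 < ν₀ ∧ ∀ ν : ℝ, 0 < ν → ν < ν₀ → ∀ μ : Measure H3,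
    Torus.IsStationaryStatisticalSolution ν f μ → Integrable (fun v : H3 => ‖v‖ ^ 2) μ →
      Torus.ensembleEnergy μ ≤ E

/-- SUB-GRASHOF statistics: `ν² · (mean energy)` of the stationary statistical solutions of `NS_ν(f)` tends to `0`
UNIFORMLY — no ν-independent mass fraction at the Grashof scale `‖u‖ ≍ ν⁻¹` ("no laminar rung" for measures). -/
def SubGrashof (f : Vec3) : Prop :=
  ∀ c : ℝ, 0 < c → ∃ ν₁ : ℝ, 0 < ν₁ ∧ ∀ ν : ℝ, 0 < ν → ν < ν₁ →
    ∀ μ : Measure H3, Torus.IsStationaryStatisticalSolution ν f μ → ν ^ 2 * Torus.ensembleEnergy μ ≤ c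

/-- The Grashof blow-down scale `4π²ν/‖f‖₂ = 1/s_f(ν)` (the FMRT support radius goes to `1`). -/
def blowdownScale (f : Vec3) (ν : ℝ) : ℝ :=
  4 * Real.pi ^ 2 * ν / Real.sqrt (∫ x, ‖f x‖ ^ 2)

/-- RESONANT EULER STATISTICS of `f` — the first-order limit class: a stationary statistical solution of EULER
(`ν = 0`, `f = 0`: probability, finite mean enstrophy, Liouville for all cylindrical tests; the shell clause is
void), carried by the closed unit ball of `H`, obeying the blown-down shell budget
`E[‖∇v‖²; a < ‖v‖² < b] ≤ 4π² E[(v,f̂)⁺; a ≤ ‖v‖² ≤ b]`, `f̂ = f/‖f‖₂` (open shell on the lsc side, closed shell and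
positive part on the usc side — the form that survives weak limits). -/
def IsResonantEulerStatistics (f : Vec3) (η : Measure H3) : Prop :=
  Torus.IsStationaryStatisticalSolution 0 (0 : Vec3) η ∧
    (∀ᵐ v ∂η, ‖v‖ ≤ 1) ∧
    ∀ a b : ℝ, 0 ≤ a → a < b →
      (∫⁻ v in {v : H3 | a < ‖v‖ ^ 2 ∧ ‖v‖ ^ 2 < b}, Torus.eGradNormSq ((v : L2) : Vec3) ∂η).toReal ≤
        4 * Real.pi ^ 2 * ∫ v in {v : H3 | a ≤ ‖v‖ ^ 2 ∧ ‖v‖ ^ 2 ≤ b},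
          max (Torus.pairing (v : L2) f / Real.sqrt (∫ x, ‖f x‖ ^ 2)) 0 ∂η

/-- GRASHOF LIMITS of `f`: weak limits (against bounded continuous observables on `H`) of the blow-downs
`(4π²ν_n/‖f‖₂) · u` of stationary statistical solutions of `NS_{ν_n}(f)` along `ν_n → 0`, together with the
first-order structure they inherit (S1). The provenance clause is what lets S3 use the force at second order. -/
def IsGrashofLimit (f : Vec3) (η : Measure H3) : Prop :=
  (∃ (ν : ℕ → ℝ) (μ : ℕ → Measure H3), (∀ n, 0 < ν n) ∧ Tendsto ν atTop (𝓝 0) ∧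
      (∀ n, Torus.IsStationaryStatisticalSolution (ν n) f (μ n)) ∧
      ∀ g : BoundedContinuousFunction H3 ℝ,
        Tendsto (fun n => ∫ v, g v ∂(Measure.map (fun u : H3 => blowdownScale f (ν n) • u) (μ n)))
          atTop (𝓝 (∫ v, g v ∂η))) ∧
    IsResonantEulerStatistics f η

/-- The radiation TAIL BOUND at `f` over a class `P` of measures: for every `ε > 0` some top region `{‖v‖ > θ}`,
`θ < 1`, carries `P`-mass at most `ε`. -/
def TopTail (P : Measure H3 → Prop) : Prop :=
  ∀ ε : ℝ, 0 < ε → ∃ θ : ℝ, θ < 1 ∧ ∀ η : Measure H3, P η → η {v : H3 | θ < ‖v‖} ≤ ENNReal.ofReal ε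

/-- Every Grashof level is null for the class `P`. -/
def GrashofFree (P : Measure H3 → Prop) : Prop :=
  ∀ θ : ℝ, 0 < θ → ∀ η : Measure H3, P η → η {v : H3 | θ < ‖v‖} = 0

/-- The statement of S0, folded. -/
def SteadyTopExclusion : Prop :=
  ∀ f : Vec3, IsAdmissibleForce f → IsFirstShell f → LambVisible f →
    ∃ θ : ℝ, θ < 1 ∧ ∃ ν₀ : ℝ, 0 < ν₀ ∧ ∀ ν : ℝ, 0 < ν → ν < ν₀ →
      ∀ u : H3, (u : L2) ∈ Torus.energySpaceV (Fin 3) → Torus.IsSteadyWeakSolution ν f u →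
        ‖u‖ ≤ θ * Real.sqrt (∫ x, ‖f x‖ ^ 2) / (4 * Real.pi ^ 2 * ν)

/-! ## Bridges (definitional) -/

theorem steadyTopExclusion_of_stub : SteadyTopExclusion := fun f hf h1 hL =>
  stub_steadyTopExclusion f hf.1 hf.2.1 hf.2.2.1 hf.2.2.2 h1 hL

theorem grashofBlowdown_of_stub (f : Vec3) (hf : IsAdmissibleForce f) (h : ¬ SubGrashof f) :
    ∃ η : Measure H3, IsGrashofLimit f η ∧ 0 < Torus.ensembleEnergy η :=
  stub_grashofBlowdown f hf.1 hf.2.1 hf.2.2.1 hf.2.2.2 h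

theorem radiationTail_of_stub (f : Vec3) (hf : IsPeelableForce f) : TopTail (IsResonantEulerStatistics f) :=
  fun ε hε => stub_radiationTail
    (fun f' hs hd hz hp h1 hL => steadyTopExclusion_of_stub f' ⟨hs, hd, hz, hp⟩ h1 hL)
    f hf.1.1 hf.1.2.1 hf.1.2.2.1 hf.1.2.2.2 hf.2.1 hf.2.2 ε hε

theorem grashofDescent_of_stub :
    ∃ f : Vec3, IsPeelableForce f ∧ (TopTail (IsGrashofLimit f) → GrashofFree (IsGrashofLimit f)) := by
  obtain ⟨f, hadm, h1, hL, himp⟩ := stub_grashofDescent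
  exact ⟨f, ⟨hadm, h1, hL⟩, himp⟩

theorem subGrashofCeiling_of_stub (f : Vec3) (hf : IsPeelableForce f) (h : SubGrashof f) : CeilingAt f :=
  stub_subGrashofCeiling f hf.1.1 hf.1.2.1 hf.1.2.2.1 hf.1.2.2.2 hf.2.1 hf.2.2 h

/-! ## Proved glue -/

/-- A Grashof limit is a resonant Euler statistics (projection). -/
theorem IsGrashofLimit.resonant {f : Vec3} {η : Measure H3} (h : IsGrashofLimit f η) :
    IsResonantEulerStatistics f η := h.2

/-- A tail bound over a larger class restricts to a smaller one. -/
theorem TopTail.mono {P Q : Measure H3 → Prop} (h : TopTail P) (hQP : ∀ η, Q η → P η) : TopTail Q := by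
  intro ε hε
  obtain ⟨θ, hθ, hθP⟩ := h ε hε
  exact ⟨θ, hθ, fun η hη => hθP η (hQP η hη)⟩

/-- **PROVED**: a measure all of whose Grashof levels `{‖v‖ > θ}`, `0 < θ < 1`, are null has mean energy `0`
(`{‖v‖ > 0} = ⋃ₙ {‖v‖ > 1/(n+2)}` is null, so `‖v‖² = 0` a.e.). -/
theorem ensembleEnergy_eq_zero_of_levels_null (η : Measure H3)
    (h : ∀ θ : ℝ, 0 < θ → θ < 1 → η {v : H3 | θ < ‖v‖} = 0) : Torus.ensembleEnergy η = 0 := by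
  have hsub : {v : H3 | 0 < ‖v‖} ⊆ ⋃ n : ℕ, {v : H3 | (1 : ℝ) / ((n : ℝ) + 2) < ‖v‖} := by
    intro v hv
    obtain ⟨n, hn⟩ := exists_nat_one_div_lt (show (0 : ℝ) < ‖v‖ from hv)
    refine Set.mem_iUnion.2 ⟨n, ?_⟩
    have h2 : (1 : ℝ) / ((n : ℝ) + 2) < 1 / ((n : ℝ) + 1) :=
      one_div_lt_one_div_of_lt (by positivity) (by linarith)
    exact lt_trans h2 hn
  have hnull : η {v : H3 | 0 < ‖v‖} = 0 := by
    refine measure_mono_null hsub (measure_iUnion_null fun n => h _ (by positivity) ?_)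
    rw [div_lt_one (by positivity)]
    linarith [n.cast_nonneg (α := ℝ)]
  have hae : ∀ᵐ v ∂η, ¬ (0 < ‖v‖) := by
    rw [ae_iff]
    simpa using hnull
  unfold Torus.ensembleEnergy
  refine integral_eq_zero_of_ae ?_
  filter_upwards [hae] with v hv
  have h0 : ‖v‖ = 0 := le_antisymm (not_lt.1 hv) (norm_nonneg v)
  simp [h0]

/-- **PROVED**: S1 (contrapositive) — if every Grashof limit of an admissible force has mean energy `0`, its
stationary statistics are uniformly sub-Grashof. -/
theorem subGrashof_of_grashofLimits_trivial (f : Vec3) (hf : IsAdmissibleForce f)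
    (h0 : ∀ η : Measure H3, IsGrashofLimit f η → Torus.ensembleEnergy η = 0) : SubGrashof f := by
  by_contra h
  obtain ⟨η, hη, hpos⟩ := grashofBlowdown_of_stub f hf h
  exact absurd (h0 η hη) (ne_of_gt hpos)

/-- **PROVED**: the Grashof regime of the line — S2's tail (over resonant statistics, hence over Grashof limits)
plus S3's descent empties every Grashof level of the witness, so its Grashof limits are trivial and (S1) its
stationary statistics are uniformly sub-Grashof. -/
theorem subGrashof_of_descent (f : Vec3) (hf : IsPeelableForce f)
    (hdesc : TopTail (IsGrashofLimit f) → GrashofFree (IsGrashofLimit f)) : SubGrashof f := by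
  have htail : TopTail (IsGrashofLimit f) :=
    (radiationTail_of_stub f hf).mono fun η hη => hη.resonant
  have hfree := hdesc htail
  refine subGrashof_of_grashofLimits_trivial f hf.1 fun η hη => ?_
  exact ensembleEnergy_eq_zero_of_levels_null η fun θ hθ _ => hfree θ hθ η hη

/-- `EnsembleCeiling ↔ ∃ f, IsAdmissibleForce f ∧ CeilingAt f` (definitional unbundling of the route decl). -/
theorem ensembleCeiling_iff : EnsembleCeiling ↔ ∃ f : Vec3, IsAdmissibleForce f ∧ CeilingAt f := by
  constructor
  · rintro ⟨f, hs, hd, hm, hp, h⟩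
    exact ⟨f, ⟨hs, hd, hm, hp⟩, h⟩
  · rintro ⟨f, ⟨hs, hd, hm, hp⟩, h⟩
    exact ⟨f, hs, hd, hm, hp, h⟩

/-- **THE COMPOSITION (kernel-checked, no sorry outside the stubs): S0 → S1 → S2 → S3 → S4 → `EnsembleCeiling`,
concluding the route decl BY NAME.** S3 supplies the witness `f` and the descent; S2 (given S0) the top tail for all
resonant Euler statistics of `f`, in particular for its Grashof limits; the descent makes every Grashof level null, so
every Grashof limit has mean energy `0`; S1 turns this into `SubGrashof f`; S4 into `CeilingAt f`; pack. The five
hypotheses are LITERALLY the statements of `stub_steadyTopExclusion`, `stub_grashofBlowdown`, `stub_radiationTail`,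
`stub_grashofDescent`, `stub_subGrashofCeiling` (tree vocabulary), consumed through the definitional bridges. -/
theorem EnsembleCeiling_of :
    (∀ f : Vec3, Torus.IsSmooth f → Torus.IsDivFree f → Torus.HasZeroMean f → 0 < (∫ x, ‖f x‖ ^ 2) →
      (∀ x, Torus.laplacian f x = -((4 * Real.pi ^ 2) • f x)) →
      (∃ w : Vec3, Torus.IsSmooth w ∧ Torus.IsDivFree w ∧ Torus.HasZeroMean w ∧
        (∫ x, inner ℝ (Torus.convect f f x) (w x)) ≠ 0) →
      ∃ θ : ℝ, θ < 1 ∧ ∃ ν₀ : ℝ, 0 < ν₀ ∧ ∀ ν : ℝ, 0 < ν → ν < ν₀ →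
        ∀ u : H3, (u : L2) ∈ Torus.energySpaceV (Fin 3) → Torus.IsSteadyWeakSolution ν f u →
          ‖u‖ ≤ θ * Real.sqrt (∫ x, ‖f x‖ ^ 2) / (4 * Real.pi ^ 2 * ν)) →
    (∀ f : Vec3, Torus.IsSmooth f → Torus.IsDivFree f → Torus.HasZeroMean f → 0 < (∫ x, ‖f x‖ ^ 2) →
      (¬ ∀ c : ℝ, 0 < c → ∃ ν₁ : ℝ, 0 < ν₁ ∧ ∀ ν : ℝ, 0 < ν → ν < ν₁ →
          ∀ μ : Measure H3, Torus.IsStationaryStatisticalSolution ν f μ → ν ^ 2 * Torus.ensembleEnergy μ ≤ c) →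
      ∃ η : Measure H3,
        ((∃ (ν : ℕ → ℝ) (μ : ℕ → Measure H3), (∀ n, 0 < ν n) ∧ Tendsto ν atTop (𝓝 0) ∧
            (∀ n, Torus.IsStationaryStatisticalSolution (ν n) f (μ n)) ∧
            ∀ g : BoundedContinuousFunction H3 ℝ,
              Tendsto (fun n => ∫ v, g v ∂(Measure.map
                (fun u : H3 => (4 * Real.pi ^ 2 * ν n / Real.sqrt (∫ x, ‖f x‖ ^ 2)) • u) (μ n)))
                atTop (𝓝 (∫ v, g v ∂η))) ∧
          (Torus.IsStationaryStatisticalSolution 0 (0 : Vec3) η ∧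
            (∀ᵐ v ∂η, ‖v‖ ≤ 1) ∧
            ∀ a b : ℝ, 0 ≤ a → a < b →
              (∫⁻ v in {v : H3 | a < ‖v‖ ^ 2 ∧ ‖v‖ ^ 2 < b}, Torus.eGradNormSq ((v : L2) : Vec3) ∂η).toReal ≤
                4 * Real.pi ^ 2 * ∫ v in {v : H3 | a ≤ ‖v‖ ^ 2 ∧ ‖v‖ ^ 2 ≤ b},
                  max (Torus.pairing (v : L2) f / Real.sqrt (∫ x, ‖f x‖ ^ 2)) 0 ∂η)) ∧
        0 < Torus.ensembleEnergy η) →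
    ((∀ f : Vec3, Torus.IsSmooth f → Torus.IsDivFree f → Torus.HasZeroMean f → 0 < (∫ x, ‖f x‖ ^ 2) →
        (∀ x, Torus.laplacian f x = -((4 * Real.pi ^ 2) • f x)) →
        (∃ w : Vec3, Torus.IsSmooth w ∧ Torus.IsDivFree w ∧ Torus.HasZeroMean w ∧
          (∫ x, inner ℝ (Torus.convect f f x) (w x)) ≠ 0) →
        ∃ θ : ℝ, θ < 1 ∧ ∃ ν₀ : ℝ, 0 < ν₀ ∧ ∀ ν : ℝ, 0 < ν → ν < ν₀ →
          ∀ u : H3, (u : L2) ∈ Torus.energySpaceV (Fin 3) → Torus.IsSteadyWeakSolution ν f u →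
            ‖u‖ ≤ θ * Real.sqrt (∫ x, ‖f x‖ ^ 2) / (4 * Real.pi ^ 2 * ν)) →
      ∀ f : Vec3, Torus.IsSmooth f → Torus.IsDivFree f → Torus.HasZeroMean f → 0 < (∫ x, ‖f x‖ ^ 2) →
        (∀ x, Torus.laplacian f x = -((4 * Real.pi ^ 2) • f x)) →
        (∃ w : Vec3, Torus.IsSmooth w ∧ Torus.IsDivFree w ∧ Torus.HasZeroMean w ∧
          (∫ x, inner ℝ (Torus.convect f f x) (w x)) ≠ 0) →
        ∀ ε : ℝ, 0 < ε → ∃ θ : ℝ, θ < 1 ∧ ∀ η : Measure H3,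
          (Torus.IsStationaryStatisticalSolution 0 (0 : Vec3) η ∧
            (∀ᵐ v ∂η, ‖v‖ ≤ 1) ∧
            ∀ a b : ℝ, 0 ≤ a → a < b →
              (∫⁻ v in {v : H3 | a < ‖v‖ ^ 2 ∧ ‖v‖ ^ 2 < b}, Torus.eGradNormSq ((v : L2) : Vec3) ∂η).toReal ≤
                4 * Real.pi ^ 2 * ∫ v in {v : H3 | a ≤ ‖v‖ ^ 2 ∧ ‖v‖ ^ 2 ≤ b},
                  max (Torus.pairing (v : L2) f / Real.sqrt (∫ x, ‖f x‖ ^ 2)) 0 ∂η) →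
          η {v : H3 | θ < ‖v‖} ≤ ENNReal.ofReal ε) →
    (∃ f : Vec3, (Torus.IsSmooth f ∧ Torus.IsDivFree f ∧ Torus.HasZeroMean f ∧ 0 < (∫ x, ‖f x‖ ^ 2)) ∧
      (∀ x, Torus.laplacian f x = -((4 * Real.pi ^ 2) • f x)) ∧
      (∃ w : Vec3, Torus.IsSmooth w ∧ Torus.IsDivFree w ∧ Torus.HasZeroMean w ∧
        (∫ x, inner ℝ (Torus.convect f f x) (w x)) ≠ 0) ∧
      ((∀ ε : ℝ, 0 < ε → ∃ θ : ℝ, θ < 1 ∧ ∀ η : Measure H3,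
          ((∃ (ν : ℕ → ℝ) (μ : ℕ → Measure H3), (∀ n, 0 < ν n) ∧ Tendsto ν atTop (𝓝 0) ∧
              (∀ n, Torus.IsStationaryStatisticalSolution (ν n) f (μ n)) ∧
              ∀ g : BoundedContinuousFunction H3 ℝ,
                Tendsto (fun n => ∫ v, g v ∂(Measure.map
                  (fun u : H3 => (4 * Real.pi ^ 2 * ν n / Real.sqrt (∫ x, ‖f x‖ ^ 2)) • u) (μ n)))
                  atTop (𝓝 (∫ v, g v ∂η))) ∧
            (Torus.IsStationaryStatisticalSolution 0 (0 : Vec3) η ∧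
              (∀ᵐ v ∂η, ‖v‖ ≤ 1) ∧
              ∀ a b : ℝ, 0 ≤ a → a < b →
                (∫⁻ v in {v : H3 | a < ‖v‖ ^ 2 ∧ ‖v‖ ^ 2 < b}, Torus.eGradNormSq ((v : L2) : Vec3) ∂η).toReal ≤
                  4 * Real.pi ^ 2 * ∫ v in {v : H3 | a ≤ ‖v‖ ^ 2 ∧ ‖v‖ ^ 2 ≤ b},
                    max (Torus.pairing (v : L2) f / Real.sqrt (∫ x, ‖f x‖ ^ 2)) 0 ∂η)) →
          η {v : H3 | θ < ‖v‖} ≤ ENNReal.ofReal ε) →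
        ∀ θ : ℝ, 0 < θ → ∀ η : Measure H3,
          ((∃ (ν : ℕ → ℝ) (μ : ℕ → Measure H3), (∀ n, 0 < ν n) ∧ Tendsto ν atTop (𝓝 0) ∧
              (∀ n, Torus.IsStationaryStatisticalSolution (ν n) f (μ n)) ∧
              ∀ g : BoundedContinuousFunction H3 ℝ,
                Tendsto (fun n => ∫ v, g v ∂(Measure.map
                  (fun u : H3 => (4 * Real.pi ^ 2 * ν n / Real.sqrt (∫ x, ‖f x‖ ^ 2)) • u) (μ n)))
                  atTop (𝓝 (∫ v, g v ∂η))) ∧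
            (Torus.IsStationaryStatisticalSolution 0 (0 : Vec3) η ∧
              (∀ᵐ v ∂η, ‖v‖ ≤ 1) ∧
              ∀ a b : ℝ, 0 ≤ a → a < b →
                (∫⁻ v in {v : H3 | a < ‖v‖ ^ 2 ∧ ‖v‖ ^ 2 < b}, Torus.eGradNormSq ((v : L2) : Vec3) ∂η).toReal ≤
                  4 * Real.pi ^ 2 * ∫ v in {v : H3 | a ≤ ‖v‖ ^ 2 ∧ ‖v‖ ^ 2 ≤ b},
                    max (Torus.pairing (v : L2) f / Real.sqrt (∫ x, ‖f x‖ ^ 2)) 0 ∂η)) →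
          η {v : H3 | θ < ‖v‖} = 0)) →
    (∀ f : Vec3, Torus.IsSmooth f → Torus.IsDivFree f → Torus.HasZeroMean f → 0 < (∫ x, ‖f x‖ ^ 2) →
      (∀ x, Torus.laplacian f x = -((4 * Real.pi ^ 2) • f x)) →
      (∃ w : Vec3, Torus.IsSmooth w ∧ Torus.IsDivFree w ∧ Torus.HasZeroMean w ∧
        (∫ x, inner ℝ (Torus.convect f f x) (w x)) ≠ 0) →
      (∀ c : ℝ, 0 < c → ∃ ν₁ : ℝ, 0 < ν₁ ∧ ∀ ν : ℝ, 0 < ν → ν < ν₁ →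
          ∀ μ : Measure H3, Torus.IsStationaryStatisticalSolution ν f μ → ν ^ 2 * Torus.ensembleEnergy μ ≤ c) →
      ∃ (E ν₀ : ℝ), 0 < ν₀ ∧ ∀ ν : ℝ, 0 < ν → ν < ν₀ → ∀ μ : Measure H3,
        Torus.IsStationaryStatisticalSolution ν f μ → Integrable (fun v : H3 => ‖v‖ ^ 2) μ →
          Torus.ensembleEnergy μ ≤ E) →
    EnsembleCeiling := by
  intro hS0 hS1 hS2 hS3 hS4
  -- fold the five hypotheses into the local vocabulary (all definitional)
  have hS0' : SteadyTopExclusion := fun f hf h1 hL => hS0 f hf.1 hf.2.1 hf.2.2.1 hf.2.2.2 h1 hL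
  have hS1' : ∀ f : Vec3, IsAdmissibleForce f → ¬ SubGrashof f →
      ∃ η : Measure H3, IsGrashofLimit f η ∧ 0 < Torus.ensembleEnergy η :=
    fun f hf h => hS1 f hf.1 hf.2.1 hf.2.2.1 hf.2.2.2 h
  have hS2' : ∀ f : Vec3, IsPeelableForce f → TopTail (IsResonantEulerStatistics f) :=
    fun f hf ε hε => hS2 (fun f' hs hd hz hp h1 hL => hS0' f' ⟨hs, hd, hz, hp⟩ h1 hL)
      f hf.1.1 hf.1.2.1 hf.1.2.2.1 hf.1.2.2.2 hf.2.1 hf.2.2 ε hε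
  obtain ⟨f, hadm, h1, hL, hdesc⟩ := hS3
  have hf : IsPeelableForce f := ⟨hadm, h1, hL⟩
  have hdesc' : TopTail (IsGrashofLimit f) → GrashofFree (IsGrashofLimit f) := hdesc
  have hS4' : SubGrashof f → CeilingAt f :=
    fun h => hS4 f hf.1.1 hf.1.2.1 hf.1.2.2.1 hf.1.2.2.2 hf.2.1 hf.2.2 h
  -- the Grashof regime: S2 tail ⊇ Grashof limits, S3 descent, zero energy, S1 contrapositive
  have htail : TopTail (IsGrashofLimit f) := (hS2' f hf).mono fun η hη => hη.resonant
  have hfree : GrashofFree (IsGrashofLimit f) := hdesc' htail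
  have h0 : ∀ η : Measure H3, IsGrashofLimit f η → Torus.ensembleEnergy η = 0 :=
    fun η hη => ensembleEnergy_eq_zero_of_levels_null η fun θ hθ _ => hfree θ hθ η hη
  have hsub : SubGrashof f := by
    by_contra h
    obtain ⟨η, hη, hpos⟩ := hS1' f hf.1 h
    exact absurd (h0 η hη) (ne_of_gt hpos)
  -- the sub-Grashof regime: S4, then pack
  obtain ⟨E, ν₀, hν₀, hceil⟩ := hS4' hsub
  obtain ⟨hs, hd, hz, hp⟩ := hadm
  exact ⟨f, hs, hd, hz, hp, E, ν₀, hν₀, hceil⟩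

/-- The same composition through the registered stubs (so that the audit sees the crux BY NAME discharged from the
five `stub_*` alone). -/
theorem ensembleCeiling_of_stubs : EnsembleCeiling :=
  EnsembleCeiling_of stub_steadyTopExclusion stub_grashofBlowdown stub_radiationTail stub_grashofDescent
    stub_subGrashofCeiling

/-! ## Proved side facts: what is necessary, and where the atoms sit -/

/-- **PROVED: `SubGrashof` is NECESSARY for the crux at `f`** (so S4's hypothesis costs nothing): a ν-uniform
ceiling `E` gives `ν² · ensembleEnergy μ ≤ ν² E ≤ c` once `ν² ≤ c/E` (the decorative integrability hypothesis of
`CeilingAt` is automatic, `IsStationaryStatisticalSolution.integrable_norm_sq`). -/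
theorem subGrashof_of_ceilingAt (f : Vec3) (h : CeilingAt f) : SubGrashof f := by
  obtain ⟨E, ν₀, hν₀, hE⟩ := h
  intro c hc
  -- below `ν₀` the ceiling holds; shrink further so that `ν² * E ≤ c`
  have hE0 : ∀ ν : ℝ, 0 < ν → ν < ν₀ → ∀ μ : Measure H3,
      Torus.IsStationaryStatisticalSolution ν f μ → Torus.ensembleEnergy μ ≤ E :=
    fun ν hν hνlt μ hμ => hE ν hν hνlt μ hμ hμ.integrable_norm_sq
  by_cases hEpos : E ≤ 0
  · refine ⟨ν₀, hν₀, fun ν hν hνlt μ hμ => ?_⟩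
    have := hE0 ν hν hνlt μ hμ
    nlinarith [sq_nonneg ν, hc]
  · have hEpos : 0 < E := lt_of_not_ge hEpos
    set ν₁ : ℝ := min ν₀ (Real.sqrt (c / E)) with hν₁
    have hcE : 0 < c / E := div_pos hc hEpos
    refine ⟨ν₁, lt_min hν₀ (Real.sqrt_pos.2 hcE), fun ν hν hνlt μ hμ => ?_⟩
    have hν0 : ν < ν₀ := lt_of_lt_of_le hνlt (min_le_left _ _)
    have hνs : ν < Real.sqrt (c / E) := lt_of_lt_of_le hνlt (min_le_right _ _)
    have hν2 : ν ^ 2 ≤ c / E := by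
      have h1 : ν ^ 2 < Real.sqrt (c / E) ^ 2 := by
        exact pow_lt_pow_left₀ hνs hν.le two_ne_zero
      rw [Real.sq_sqrt hcE.le] at h1
      exact h1.le
    have hEμ := hE0 ν hν hν0 μ hμ
    calc ν ^ 2 * Torus.ensembleEnergy μ ≤ ν ^ 2 * E := by
          exact mul_le_mul_of_nonneg_left hEμ (sq_nonneg ν)
      _ ≤ (c / E) * E := by exact mul_le_mul_of_nonneg_right hν2 hEpos.le
      _ = c := by field_simp

/-- **PROVED: the atoms' reading of S0's regime** (Disproof §0 `ceilingAt_steady_bound`, re-derived through the landed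
`DiracAtoms.norm_sq_le_of_ceiling`): a ceiling at `f` bounds every finite-enstrophy steady state — the converse use of
the Dirac members that S0 bounds from the top. -/
theorem steady_norm_sq_le_of_ceilingAt {f : Vec3} (hf : MemLp f 2 volume) (h : CeilingAt f) :
    ∃ (E ν₀ : ℝ), 0 < ν₀ ∧ ∀ ν : ℝ, 0 < ν → ν < ν₀ → ∀ u : H3,
      (u : L2) ∈ Torus.energySpaceV (Fin 3) → Torus.IsSteadyWeakSolution ν f u → ‖u‖ ^ 2 ≤ E := by
  obtain ⟨E, ν₀, hν₀, h⟩ := h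
  exact ⟨E, ν₀, hν₀, fun ν hν hνlt u hV hu => norm_sq_le_of_ceiling hν hf (h ν hν hνlt) hV hu⟩

end Summit.AnomalousDissipation.AnomalousDissipation.Cruxes.EnsembleCeiling.RadiationFunctionalOuterPeeling
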